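import Mathlib
import Summits.KontsevichZagierPeriods.Zeta5Search.DenomLaw.PathWeightProfile
import Summits.KontsevichZagierPeriods.Zeta5Search.DenomLaw.TopFamilyCRLevels
import HarnessLib

/-!
# ζ(5) search — `C⋆` on the θ-cells of the TOP linear family (profile checks over the 5,040 vertex orderings), all `t`, all `n`

Cell `pub-zeta5` (HONEST FRAMING: systematic search; no irrationality claim unless certified), TRACK «DENOM-LAW» D1 prover seat
(denom-prover-d1 g16, `HOME/denom-law/prover-d1/ATTEMPT-16.md`).  The PATH ACCOUNTING node's combinatorial datum `C⋆_p(b) = cStar b p` on the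
TOP linear family `bTop t n = bLin (t n + 2n) (t n) n = n·(3t+16; t+8, …, t+2)` (parameters `(t+8−i)·n`, pair blocks `(t+i+k)·n` for `0 ≤ i < k ≤ 6`):
by the tree's profile tool `cStar_le_of_profile` (`DenomLaw/PathWeightProfile`, g11), a lower bound `p > (t+c)·n` restricts which parameters (`8 − i > c`)
and which pair blocks (`i + k > c`) may reach `p` — a profile that does NOT depend on `t` or `n` — and one `decide +kernel` over the 5,040 orderings
bounds `C⋆`: `≤ 9` for `p > (t+4)n`, `≤ 8` for `p > (t+5)n`, `≤ 6` for `p > (t+6)n`, `≤ 5` for `p > (t+7)n` (each attained on the next cell: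
`HOME/…/g16/tables/top_cells.txt`; on `((t+1)n, (t+4)n]` the tree's generic `cStar_le_eleven` is sharp).  Consumed by `DenomLaw/TopFamilyFPPath`.
Pure combinatorics; nothing about ζ(5) or irrationality.
-/

open Finset

namespace Summit.KontsevichZagierPeriods.Zeta5Search.TopFamFP

open Summit.KontsevichZagierPeriods.Zeta5Search.DenomLaw (cStar)
open Summit.KontsevichZagierPeriods.Zeta5Search.DenomLaw.FirstPeriodKit (cStar_le_of_profile)
open Summit.KontsevichZagierPeriods.Zeta5Search.CellKit
open Summit.KontsevichZagierPeriods.Zeta5Search.TopFamCR (tf_zero)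

/-- The family's lower parameters: `bTop t n (i+1) = (t + 8 − i)·n` for `i < 7`. -/
theorem tf_param (t n : ℕ) (i : Fin 7) : bLin (t * n + 2 * n) (t * n) n (i.val + 1) = ((t : ℤ) + 8 - (i.val : ℤ)) * n := by
  fin_cases i <;> simp [bLin] <;> ring

/-- The family's pair blocks: `b₀ − b_{i+1} − b_{k+1} = (t + i + k)·n`. -/
theorem tf_block (t n : ℕ) (i k : Fin 7) :
    bLin (t * n + 2 * n) (t * n) n 0 - bLin (t * n + 2 * n) (t * n) n (i.val + 1) - bLin (t * n + 2 * n) (t * n) n (k.val + 1)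
      = ((t : ℤ) + i.val + k.val) * n := by
  rw [tf_param, tf_param, tf_zero]; push_cast; ring

/-- Profile bound: for `p > (t+c)·n`, only parameters with `8 − i > c` and blocks with `i + k > c` can reach `p`, so `C⋆ ≤ K` once the
5,040-ordering check at that profile passes (the profile is independent of `t` and `n`). -/
theorem cStar_tf_le_of {t n p c K : ℕ} (hp : t * n + c * n < p)
    (hdec : ((List.finRange 7).permutations'.all fun l : List (Fin 7) => decide (
      ((univ : Finset (Fin 5)).filter fun s => (l.getD (s.val + 1) 0).val + c < 8).card +
      ((univ : Finset (Fin 6)).filter fun s => c < (l.getD s.val 0).val + (l.getD (s.val + 1) 0).val).card ≤ K)) = true) :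
    cStar (bLin (t * n + 2 * n) (t * n) n) p ≤ K := by
  have hp' : ((t : ℤ) + c) * n < p := by
    have h := hp; zify at h; linarith
  have hn0 : (0 : ℤ) ≤ n := by positivity
  refine cStar_le_of_profile (fun i : Fin 7 => i.val + c < 8) (fun i k : Fin 7 => c < i.val + k.val) K ?_ ?_ hdec
  · intro i hi
    rw [tf_param] at hi
    by_contra hc
    push Not at hc
    have hc' : ((t : ℤ) + 8 - (i.val : ℤ)) * n ≤ ((t : ℤ) + c) * n :=
      mul_le_mul_of_nonneg_right (by omega) hn0
    linarith
  · intro i k hik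
    rw [tf_block] at hik
    by_contra hc
    push Not at hc
    have hc' : ((t : ℤ) + i.val + k.val) * n ≤ ((t : ℤ) + c) * n :=
      mul_le_mul_of_nonneg_right (by omega) hn0
    linarith

/-- **`C⋆ ≤ 9` for `p > (t+4)n`** (attained on `((t+4)n, (t+5)n]`). -/
theorem cStar_tf_le_nine {t n p : ℕ} (hp : t * n + 4 * n < p) : cStar (bLin (t * n + 2 * n) (t * n) n) p ≤ 9 :=
  cStar_tf_le_of hp (by decide +kernel)

/-- **`C⋆ ≤ 8` for `p > (t+5)n`** (attained on `((t+5)n, (t+6)n]`). -/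
theorem cStar_tf_le_eight {t n p : ℕ} (hp : t * n + 5 * n < p) : cStar (bLin (t * n + 2 * n) (t * n) n) p ≤ 8 :=
  cStar_tf_le_of hp (by decide +kernel)

/-- **`C⋆ ≤ 6` for `p > (t+6)n`** (attained on `((t+6)n, (t+7)n]`). -/
theorem cStar_tf_le_six {t n p : ℕ} (hp : t * n + 6 * n < p) : cStar (bLin (t * n + 2 * n) (t * n) n) p ≤ 6 :=
  cStar_tf_le_of hp (by decide +kernel)

/-- **`C⋆ ≤ 5` for `p > (t+7)n`** (attained on `((t+7)n, (t+8)n]`). -/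
theorem cStar_tf_le_five {t n p : ℕ} (hp : t * n + 7 * n < p) : cStar (bLin (t * n + 2 * n) (t * n) n) p ≤ 5 :=
  cStar_tf_le_of hp (by decide +kernel)

end Summit.KontsevichZagierPeriods.Zeta5Search.TopFamFP
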